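import Summits.NavierStokesRegularity.NavierStokesRegularity.Theses.RellichScar
import Summits.NavierStokesRegularity.NavierStokesRegularity.Theorems.ScarRigidity.Negative.LogicAndLoadBearing
import Summits.NavierStokesRegularity.NavierStokesRegularity.Theorems.RellichScarScarRigidityApexMild
import Summits.NavierStokesRegularity.NavierStokesRegularity.Theorems.RellichScarDefs
import Summits.NavierStokesRegularity.NavierStokesRegularity.Theorems.RellichScarScarRigidityMomentLadderReduction
import Summits.NavierStokesRegularity.NavierStokesRegularity.Theorems.RellichScarScarRigidityFarFieldAllOrders
import Summits.NavierStokesRegularity.NavierStokesRegularity.Theorems.RellichScarScarRigidityApexRegularity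
import Summits.NavierStokesRegularity.NavierStokesRegularity.Theorems.RellichScarScarRigidityPaintedLadderHigher
import Literature.Analysis.FluidPDE.TypeIAncientMild
import HarnessLib

/-!
# `ScarRigidity` — line `moment-conditioned-rellich`: the line's UNCONDITIONAL output and its honest residual
# (crux stmt-NavierStokesRegularity-11717, route RellichScar; lead a1, cycle 1 consolidation)

Everything the line can prove about two scar-sharing Type-I apex profiles is now in the tree, spread over the
landed stub files of leads 0 / b / a1.  This file states the results ONCE, in route vocabulary, so that planners and
ideators can cite them by name without reading twenty-five helper files:

* `scarTwins_farDecay_four` — **scar twins are quartically flat**: two Type-I ancient mild apex profiles at the same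
  constant `C > 0` with the same scar (`SameScar`: `ess sup` of `‖V₁ − V₂‖` over `(−δ,0) × K` tends to `0` for every
  compact `K ∌ 0`) differ, with all spatial derivatives, by `O((−t)^{3/2}‖x‖^{−4−k})` on the parabolic exterior
  `√(−t) ≤ ‖x‖` (`FarDecay 4`).  Ingredients: smooth pressures and the all-orders scale-invariant package
  (`stub_apexRegularity`, p116186), cubic flatness from the scar (`stub_farFieldAllOrders`, p82645), rung one of the
  painted ladder (`farDecay_four_of_three`, p123343 — a second, pressure-free proof goes through
  `stub_vorticityDefectDecay` p120150 + `stub_biotSavartFarField` p123166).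
* `scarTwins_farDecay_four_apexClass` — the same for a pair of the ROUTE's apex class (suitable weak, `𝐈 < ∞`, apex
  bound, same scar): a.e.-equal smooth representatives exist which are quartically flat twins.
* `scarTwins_farDecay_of_radiativeMoments` — the whole conditional ladder in one line: if the radiative moments of
  degrees `2 … ℓ` vanish, the twins are flat of order `ℓ + 3`.
* `scarRigidity_of_allOrdersFlat_of_flatRigidity` — **the honest residual of the line**: `ScarRigidity` follows from
  (AOF) "scar twins which are quartically flat are flat to every order" and (FSR) "all-orders-flat twins coincide"
  (= the registered `stub_flatScarRigidity`).  Both are OPEN: by the worker analyses of cycle 1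
  (`Cruxes/ScarRigidity/Lines/moment-conditioned-rellich-HM-analysis.md`, `…-FSR-analysis.md`) rung `ℓ` of (AOF)
  (`stub_higherMomentsVanish`, `stub_quadrupoleDefectVanishes`) is EQUIVALENT to `FarDecay (ℓ+3)` itself — the
  degree-`ℓ` radiative moment is the exact time derivative of the convergent toroidal vorticity moment
  `μ_H = (ℓ+1)⁻¹∫(∇H × y)·curl(V₁−V₂)`, and the only pressure-free closed linear laws of the defect are momentum and
  angular momentum (degree ≤ 1) — while (FSR) is blocked by the kernel of the exterior div–curl problem (the tree's ESS
  exterior backward uniqueness needs a pointwise inequality; the vorticity equation of the difference carries the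
  non-local `w = BiotSavart(curl w)`).  Both need unique continuation from spatial infinity for the EXACT linearised
  system `∂ₛW = (Δ − ½y·∇ − ½)W − Ū·∇W − W·∇Ū − ∇Π` across the parabolic core — not a size-based estimate
  (Disproof §7 neutral mode).

No new definitions; no sorry.
-/

noncomputable section

open Set Filter Function MeasureTheory Metric TopologicalSpace
open scoped Topology ENNReal NNReal InnerProductSpace RealInnerProductSpace
open Literature.Analysis.FluidPDE
open Summit.NavierStokesRegularity.NavierStokesRegularity.Theses.RellichScar
open Summit.NavierStokesRegularity.NavierStokesRegularity.Theorems.ScarRigidity.Negative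

set_option linter.dupNamespace false

namespace Summit.NavierStokesRegularity.NavierStokesRegularity.Theorems.RellichScarScarRigidity

/-- Physical space. -/
local notation "ℝ³" => EuclideanSpace ℝ (Fin 3)

open MomentLadder

/-- **Scar twins are quartically flat (unconditional output of the line).**  Two Type-I ancient mild apex profiles at
the same constant `C > 0` with the same scar differ, with all spatial derivatives, by `O((−t)^{3/2}‖x‖^{−4−k})` on the
parabolic exterior `√(−t) ≤ ‖x‖`: `FarDecay 4`.  (Smooth decaying-gauge pressures and the all-orders package by
`stub_apexRegularity`; cubic flatness from the scar by `stub_farFieldAllOrders`; rung one of the painted ladder,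
`farDecay_four_of_three`.) -/
theorem scarTwins_farDecay_four :
    ∀ (V₁ V₂ : ℝ → ℝ³ → ℝ³) (C : ℝ), 0 < C →
      IsTypeIAncientMild C V₁ → IsTypeIAncientMild C V₂ → HasTypeIDecay C V₁ → HasTypeIDecay C V₂ →
      SameScar V₁ V₂ → FarDecay 4 V₁ V₂ := by
  intro V₁ V₂ C hC hm₁ hm₂ hd₁ hd₂ hscar
  obtain ⟨Q₁, hcl₁, hB₁⟩ := stub_apexRegularity V₁ C hC hm₁ hd₁
  obtain ⟨Q₂, hcl₂, hB₂⟩ := stub_apexRegularity V₂ C hC hm₂ hd₂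
  exact farDecay_four_of_three hcl₁ hcl₂ hB₁ hB₂ (stub_farFieldAllOrders V₁ V₂ Q₁ Q₂ hcl₁ hcl₂ hB₁ hB₂ hscar)

/-- **Quartic flatness for a pair of the route's apex class.**  Two suitable weak solutions on the slab with `𝐈 < ∞`
and the apex bound at the same constant `C > 0`, with the same scar, have a.e.-equal smooth representatives (Type-I
ancient mild, apex bound) which are quartically flat twins.  (Representatives by `stub_apexMildRepresentative`; the
scar passes to a.e.-equal fields, `sameScar_congr_ae`.)  The singularity of the profiles is not needed here. -/
theorem scarTwins_farDecay_four_apexClass :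
    ∀ (u₁ : ℝ → ℝ³ → ℝ³) (p₁ : ℝ → ℝ³ → ℝ) (G₁ : ℝ → ℝ³ → ℝ³ →L[ℝ] ℝ³)
      (u₂ : ℝ → ℝ³ → ℝ³) (p₂ : ℝ → ℝ³ → ℝ) (G₂ : ℝ → ℝ³ → ℝ³ →L[ℝ] ℝ³) (C : ℝ), 0 < C →
      IsSuitableWeakSolutionOn (slab (EuclideanSpace ℝ (Fin 3)) (Iio (0 : ℝ)) isOpen_Iio) 1 0 u₁ p₁ →
      HasWeakSpatialGradientOn (slab (EuclideanSpace ℝ (Fin 3)) (Iio (0 : ℝ)) isOpen_Iio) u₁ G₁ →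
      typeIBound (Iio (0 : ℝ) ×ˢ univ) u₁ p₁ G₁ < ⊤ → HasTypeIDecay C u₁ →
      IsSuitableWeakSolutionOn (slab (EuclideanSpace ℝ (Fin 3)) (Iio (0 : ℝ)) isOpen_Iio) 1 0 u₂ p₂ →
      HasWeakSpatialGradientOn (slab (EuclideanSpace ℝ (Fin 3)) (Iio (0 : ℝ)) isOpen_Iio) u₂ G₂ →
      typeIBound (Iio (0 : ℝ) ×ˢ univ) u₂ p₂ G₂ < ⊤ → HasTypeIDecay C u₂ →
      SameScar u₁ u₂ →
      ∃ V₁ V₂ : ℝ → ℝ³ → ℝ³,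
        uncurry V₁ =ᵐ[volume.restrict (Iio (0 : ℝ) ×ˢ (univ : Set ℝ³))] uncurry u₁ ∧
        uncurry V₂ =ᵐ[volume.restrict (Iio (0 : ℝ) ×ˢ (univ : Set ℝ³))] uncurry u₂ ∧
        IsTypeIAncientMild C V₁ ∧ IsTypeIAncientMild C V₂ ∧ HasTypeIDecay C V₁ ∧ HasTypeIDecay C V₂ ∧
        FarDecay 4 V₁ V₂ := by
  intro u₁ p₁ G₁ u₂ p₂ G₂ C hC hs₁ hg₁ hI₁ hd₁ hs₂ hg₂ hI₂ hd₂ hscar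
  obtain ⟨V₁, hae₁, hm₁, hdV₁⟩ := stub_apexMildRepresentative u₁ p₁ G₁ C hC hs₁ hg₁ hI₁ hd₁
  obtain ⟨V₂, hae₂, hm₂, hdV₂⟩ := stub_apexMildRepresentative u₂ p₂ G₂ C hC hs₂ hg₂ hI₂ hd₂
  exact ⟨V₁, V₂, hae₁, hae₂, hm₁, hm₂, hdV₁, hdV₂,
    scarTwins_farDecay_four V₁ V₂ C hC hm₁ hm₂ hdV₁ hdV₂ (sameScar_congr_ae hae₁ hae₂ hscar)⟩

/-- **The conditional ladder in one line.**  If the radiative moments of the Reynolds-stress defect of degrees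
`2 … ℓ` vanish, scar twins are flat of order `ℓ + 3` (`farDecay_of_moments` on top of `scarTwins_farDecay_four`'s
ingredients). -/
theorem scarTwins_farDecay_of_radiativeMoments :
    ∀ (V₁ V₂ : ℝ → ℝ³ → ℝ³) (C : ℝ) (ℓ : ℕ), 0 < C →
      IsTypeIAncientMild C V₁ → IsTypeIAncientMild C V₂ → HasTypeIDecay C V₁ → HasTypeIDecay C V₂ →
      SameScar V₁ V₂ → (∀ ℓ' : ℕ, 2 ≤ ℓ' → ℓ' ≤ ℓ → RadiativeMomentsVanish ℓ' V₁ V₂) →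
      FarDecay (ℓ + 3) V₁ V₂ := by
  intro V₁ V₂ C ℓ hC hm₁ hm₂ hd₁ hd₂ hscar hmom
  obtain ⟨Q₁, hcl₁, hB₁⟩ := stub_apexRegularity V₁ C hC hm₁ hd₁
  obtain ⟨Q₂, hcl₂, hB₂⟩ := stub_apexRegularity V₂ C hC hm₂ hd₂
  exact farDecay_of_moments hcl₁ hcl₂ hB₁ hB₂
    (stub_farFieldAllOrders V₁ V₂ Q₁ Q₂ hcl₁ hcl₂ hB₁ hB₂ hscar) ℓ hmom

/-- **The honest residual of the line.**  `ScarRigidity` follows from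
(AOF) quartically flat scar twins (Type-I ancient mild, apex bound, classical with the package, singular at the origin)
are flat to every order, and (FSR) all-orders-flat twins coincide (the registered `stub_flatScarRigidity`, verbatim).
Both hypotheses are open (see the module docstring); everything else is landed. -/
theorem scarRigidity_of_allOrdersFlat_of_flatRigidity :
    (∀ (V₁ V₂ : ℝ → ℝ³ → ℝ³) (Q₁ Q₂ : ℝ → ℝ³ → ℝ) (C : ℝ), 0 < C →
      IsTypeIAncientMild C V₁ → IsTypeIAncientMild C V₂ → HasTypeIDecay C V₁ → HasTypeIDecay C V₂ →
      IsClassicalNSSolutionOn (Iio (0 : ℝ)) 1 0 V₁ Q₁ → IsClassicalNSSolutionOn (Iio (0 : ℝ)) 1 0 V₂ Q₂ →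
      ScaleInvariantBounds V₁ Q₁ → ScaleInvariantBounds V₂ Q₂ →
      IsBackwardSingularPoint V₁ 0 → IsBackwardSingularPoint V₂ 0 →
      FarDecay 4 V₁ V₂ → ∀ N : ℕ, FarDecay N V₁ V₂) →
    (∀ (V₁ V₂ : ℝ → ℝ³ → ℝ³) (Q₁ Q₂ : ℝ → ℝ³ → ℝ) (C : ℝ), 0 < C →
      IsTypeIAncientMild C V₁ → IsTypeIAncientMild C V₂ → HasTypeIDecay C V₁ → HasTypeIDecay C V₂ →
      IsClassicalNSSolutionOn (Iio (0 : ℝ)) 1 0 V₁ Q₁ → IsClassicalNSSolutionOn (Iio (0 : ℝ)) 1 0 V₂ Q₂ →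
      ScaleInvariantBounds V₁ Q₁ → ScaleInvariantBounds V₂ Q₂ →
      IsBackwardSingularPoint V₁ 0 → IsBackwardSingularPoint V₂ 0 →
      (∀ N : ℕ, FarDecay N V₁ V₂) → ∀ t < 0, ∀ x : ℝ³, V₁ t x = V₂ t x) →
    ScarRigidity := by
  intro hAOF hFSR
  rw [scarRigidity_iff_pos]
  intro C hC u₁ p₁ G₁ u₂ p₂ G₂ hs₁ hg₁ hI₁ hd₁ hs₂ hg₂ hI₂ hd₂ hsing₁ hsing₂ hscar
  obtain ⟨V₁, hae₁, hm₁, hdV₁⟩ := stub_apexMildRepresentative u₁ p₁ G₁ C hC hs₁ hg₁ hI₁ hd₁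
  obtain ⟨V₂, hae₂, hm₂, hdV₂⟩ := stub_apexMildRepresentative u₂ p₂ G₂ C hC hs₂ hg₂ hI₂ hd₂
  obtain ⟨Q₁, hcl₁, hB₁⟩ := stub_apexRegularity V₁ C hC hm₁ hdV₁
  obtain ⟨Q₂, hcl₂, hB₂⟩ := stub_apexRegularity V₂ C hC hm₂ hdV₂
  have hscarV : SameScar V₁ V₂ := sameScar_congr_ae hae₁ hae₂ hscar
  have hsV₁ : IsBackwardSingularPoint V₁ 0 := isBackwardSingularPoint_congr_ae hae₁ hsing₁
  have hsV₂ : IsBackwardSingularPoint V₂ 0 := isBackwardSingularPoint_congr_ae hae₂ hsing₂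
  have hF4 : FarDecay 4 V₁ V₂ :=
    farDecay_four_of_three hcl₁ hcl₂ hB₁ hB₂ (stub_farFieldAllOrders V₁ V₂ Q₁ Q₂ hcl₁ hcl₂ hB₁ hB₂ hscarV)
  have hall : ∀ N : ℕ, FarDecay N V₁ V₂ :=
    hAOF V₁ V₂ Q₁ Q₂ C hC hm₁ hm₂ hdV₁ hdV₂ hcl₁ hcl₂ hB₁ hB₂ hsV₁ hsV₂ hF4
  have heq := hFSR V₁ V₂ Q₁ Q₂ C hC hm₁ hm₂ hdV₁ hdV₂ hcl₁ hcl₂ hB₁ hB₂ hsV₁ hsV₂ hall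
  have hV : uncurry V₁ =ᵐ[volume.restrict (Iio (0 : ℝ) ×ˢ (univ : Set ℝ³))] uncurry V₂ :=
    ae_slab_of_forall (P := fun z => uncurry V₁ z = uncurry V₂ z) fun t ht x => heq t ht x
  exact (hae₁.symm.trans hV).trans hae₂

end Summit.NavierStokesRegularity.NavierStokesRegularity.Theorems.RellichScarScarRigidity

end
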